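import Summits.QuantumFields.BalabanUV.T4Continuum.Support.SkeletonPrecompTools

/-!
# T⁴ programme, node NE3 — the kinematic refinement lemma, leaf R1a (row NE3-S4c), file 6:
# THE FLUX OF THE PRE-COMPENSATED DATUM TO FIRST ORDER — `log T(∂p) = log U(∂p) + D + O(x₀² + x₀a)` with the explicit
# shift `D = −X₀(z,κ) − Ad_{U(z,κ)}X₀(z+e_κ,ν) + Ad_Q X₀(z+e_ν,κ) + Ad_{U(∂p)} X₀(z,ν)`

Cell `pub-balaban`, NE3 (node U1b) formalisation swarm, unit `b2b-balaban-t4-ne3-formalise-leaf-01` (LEAF PROVER 01),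
row **S4c** of `t4/formal/NE3/LEAVES.md` (leaf R1a; socket NE3-R1 `ApproxRefine`).  With `T = precomp L U = exp(−X₀)·U`
(file 4) and a plaquette `p = (z; κ < ν)`:
* `hol_precomp_plaqWord_eq` — THE FACTORISATION `T(∂p) = [e^{−X₁} · Ad_{U₁}e^{−X₂} · Ad_Q e^{X₃} · Ad_{U(∂p)} e^{X₄}] · U(∂p)`
  (`X₁ = X₀(z,κ)`, `X₂ = X₀(z+e_κ,ν)`, `X₃ = X₀(z+e_ν,κ)`, `X₄ = X₀(z,ν)`; `U₁ = U(z,κ)`, `Q = U(z,κ)U(z+e_κ,ν)U(z+e_ν,κ)⁻¹`;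
  an identity in the group of units, `group`);
* `fluxShift L U z κ ν = D` and `norm_fluxShift_le` (`‖D‖ ≤ 4x₀`);
* **`norm_flux_precomp_sub_le`**: `‖flux T p − flux U p − D‖ ≤ 156x₀² + 24x₀a` for `‖X₀‖ ≤ x₀ ≤ 1/32`, `SmallField U a`,
  `a ≤ 1/4`, `U` unitary — second-order expansion of the four insertions (file 5) + the mean-value defect of `log`
  (tree `FederbushMean.norm_mlog_sub_mlog_sub_le`).  With `x₀ = (d−1)a` (file 4 `norm_X0_le`) the remainder is `O(a²)`.
The covariant GRADIENT of `flux T` (the socket's `c₁`) is assembled from this and file 5's `norm_covGradX0_le` in the next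
file (`SkeletonPrecompGrad`).

HONEST FRAMING.  Elementary matrix analysis; no estimate of the series, no minimiser; no conditional of the cell
(`BetaPertH`, (B), (B^μ)) is used or hidden; nothing bears on infinite volume, a mass gap, or the Clay problem; **NE3 is
NOT proved**, `SmoothRefine` ∕ `ApproxRefine` are NOT proved here.  Finite T⁴ rung (B)+1.  ABSOLUTE RULE kept: no printed
sentence is a hypothesis of any declaration; no `sorry`, axioms ⊆ {propext, Classical.choice, Quot.sound}.  PLACEMENT
(human rule 2026-08-19): cell work under `Summits/QuantumFields/BalabanUV/`; imports file 5 only; moves nothing.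
-/

set_option autoImplicit false

open scoped BigOperators Matrix Matrix.Norms.L2Operator
open NormedSpace Finset

namespace Summit.QuantumFields.BalabanUV.T4Continuum.SkeletonPrecompFlux

open Literature.MathematicalPhysics.QuantumFieldTheory.Balaban1983to89
open B7Prop1Explicit B7Prop2Explicit B7Prop1Local MatrixLog
open T4AveragingDeficitWall hiding Site Plane Plaq Bond
open AveragingDeficitTransport (norm_Ad_of_unitary mem_U1_of_unitary)
open AveragingDeficitNearIdentity (Ad_one Ad_real_smul Ad_add Ad_neg Ad_sum norm_Ad_sub_le)
open T4AveragingDeficitNonAbelian (Ad_mul Ad_sub)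
open SkeletonPrecomp SkeletonPrecompTools

noncomputable section

variable {d : ℕ} {n : Type*} [Fintype n] [DecidableEq n]

/-! ## §1 The plaquette holonomy of `T = exp(−X₀)·U`: the four insertions, and the flux to first order -/

section Flux

variable (L : ℕ) (U : B7Prop1Explicit.Site d → Fin d → (Matrix n n ℂ)ˣ) (z : B7Prop1Explicit.Site d) (κ ν : Fin d)

/-- The transporter `Q = U(z,κ)U(z+e_κ,ν)U(z+e_ν,κ)⁻¹` (three sides of the plaquette). [folklore] -/
def threeSides : (Matrix n n ℂ)ˣ := U z κ * U (z + e κ) ν * (U (z + e ν) κ)⁻¹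

/-- Insertion 1: `e^{−X₀(z,κ)}`. [folklore] -/
def ins1 : (Matrix n n ℂ)ˣ := expUnit (-X0 L U z κ)
/-- Insertion 2: `Ad_{U(z,κ)} e^{−X₀(z+e_κ,ν)}`. [folklore] -/
def ins2 : (Matrix n n ℂ)ˣ := U z κ * expUnit (-X0 L U (z + e κ) ν) * (U z κ)⁻¹
/-- Insertion 3: `Ad_Q e^{X₀(z+e_ν,κ)}`. [folklore] -/
def ins3 : (Matrix n n ℂ)ˣ := threeSides U z κ ν * expUnit (X0 L U (z + e ν) κ) * (threeSides U z κ ν)⁻¹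
/-- Insertion 4: `Ad_{U(∂p)} e^{X₀(z,ν)}`. [folklore] -/
def ins4 : (Matrix n n ℂ)ˣ := hol U z (plaqWord κ ν) * expUnit (X0 L U z ν) * (hol U z (plaqWord κ ν))⁻¹

/-- **THE FACTORISATION** `T(∂p) = [e^{−X₁} · Ad_{U₁}e^{−X₂} · Ad_Q e^{X₃} · Ad_{U(∂p)} e^{X₄}] · U(∂p)` of the plaquette
holonomy of the pre-compensated datum (an identity in the group of units). [folklore] -/
theorem hol_precomp_plaqWord_eq :
    hol (precomp L U) z (plaqWord κ ν)
      = ins1 L U z κ * ins2 L U z κ ν * ins3 L U z κ ν * ins4 L U z κ ν * hol U z (plaqWord κ ν) := by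
  have h3 : expUnit (X0 L U (z + e ν) κ) = (expUnit (-X0 L U (z + e ν) κ))⁻¹ := by
    rw [val_inv_expUnit, neg_neg]
  have h4 : expUnit (X0 L U z ν) = (expUnit (-X0 L U z ν))⁻¹ := by
    rw [val_inv_expUnit, neg_neg]
  simp only [ins1, ins2, ins3, ins4, threeSides, hol_plaqWord_eq, precomp, h3, h4]
  group

variable {L U z κ ν}

/-- The shift `D = −X₀(z,κ) − Ad_{U₁}X₀(z+e_κ,ν) + Ad_Q X₀(z+e_ν,κ) + Ad_{U(∂p)} X₀(z,ν)` — the first-order change of the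
flux under the pre-compensation. [folklore] -/
def fluxShift (L : ℕ) (U : B7Prop1Explicit.Site d → Fin d → (Matrix n n ℂ)ˣ) (z : B7Prop1Explicit.Site d)
    (κ ν : Fin d) : Matrix n n ℂ :=
  -X0 L U z κ - Ad (U z κ) (X0 L U (z + e κ) ν) + Ad (threeSides U z κ ν) (X0 L U (z + e ν) κ)
    + Ad (hol U z (plaqWord κ ν)) (X0 L U z ν)

/-- `‖D‖ ≤ 4x₀`. [folklore] -/
theorem norm_fluxShift_le (hU : IsUnitaryCfg U) {x₀ : ℝ} (hX : ∀ z κ, ‖X0 L U z κ‖ ≤ x₀) :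
    ‖fluxShift L U z κ ν‖ ≤ 4 * x₀ := by
  unfold fluxShift
  have hQ : threeSides U z κ ν ∈ unitaryUnits (Matrix n n ℂ) :=
    (unitaryUnits _).mul_mem ((unitaryUnits _).mul_mem (hU _ _) (hU _ _)) ((unitaryUnits _).inv_mem (hU _ _))
  have n1 := hX z κ
  have n2 : ‖Ad (U z κ) (X0 L U (z + e κ) ν)‖ ≤ x₀ := by rw [norm_Ad_of_unitary (hU z κ)]; exact hX _ _
  have n3 : ‖Ad (threeSides U z κ ν) (X0 L U (z + e ν) κ)‖ ≤ x₀ := by rw [norm_Ad_of_unitary hQ]; exact hX _ _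
  have n4 : ‖Ad (hol U z (plaqWord κ ν)) (X0 L U z ν)‖ ≤ x₀ := by
    rw [norm_Ad_of_unitary (hol_mem_of hU _ _)]; exact hX _ _
  calc _ ≤ ‖-X0 L U z κ - Ad (U z κ) (X0 L U (z + e κ) ν) + Ad (threeSides U z κ ν) (X0 L U (z + e ν) κ)‖
        + ‖Ad (hol U z (plaqWord κ ν)) (X0 L U z ν)‖ := norm_add_le _ _
    _ ≤ (‖-X0 L U z κ - Ad (U z κ) (X0 L U (z + e κ) ν)‖ + ‖Ad (threeSides U z κ ν) (X0 L U (z + e ν) κ)‖) + x₀ :=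
        add_le_add (norm_add_le _ _) n4
    _ ≤ ((‖-X0 L U z κ‖ + ‖Ad (U z κ) (X0 L U (z + e κ) ν)‖) + x₀) + x₀ := by
        gcongr
        exact norm_sub_le _ _
    _ ≤ ((x₀ + x₀) + x₀) + x₀ := by rw [norm_neg]; gcongr
    _ = 4 * x₀ := by ring

/-- `e^{X₀}` is unitary too. [folklore] -/
theorem expUnit_X0_mem_unitary (L : ℕ) (hU : IsUnitaryCfg U) {a : ℝ} (hs : SmallField U a) (ha : a ≤ 1 / 4)
    (z : B7Prop1Explicit.Site d) (κ : Fin d) : expUnit (X0 L U z κ) ∈ unitaryUnits (Matrix n n ℂ) := by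
  letI : CStarAlgebra (Matrix n n ℂ) := {}
  letI : NormedAlgebra ℚ (Matrix n n ℂ) := NormedAlgebra.restrictScalars ℚ ℝ (Matrix n n ℂ)
  rw [mem_unitaryUnits, val_expUnit]
  exact NormedSpace.exp_mem_unitary_of_mem_skewAdjoint (X0_mem_skewAdjoint L hU hs ha z κ)

/-- **THE FLUX OF THE PRE-COMPENSATED DATUM TO FIRST ORDER**: for `κ < ν`,
`‖log T(∂p_{κν}(z)) − log U(∂p_{κν}(z)) − D‖ ≤ 156x₀² + 24x₀a` whenever `‖X₀‖ ≤ x₀ ≤ 1/32` and `SmallField U a`,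
`a ≤ 1/4` (second-order expansion of the four insertions + the mean-value defect of `log`,
`FederbushMean.norm_mlog_sub_mlog_sub_le`). [folklore] -/
theorem norm_flux_precomp_sub_le (hU : IsUnitaryCfg U) {a : ℝ} (hs : SmallField U a) (ha : a ≤ 1 / 4)
    {x₀ : ℝ} (hX : ∀ z κ, ‖X0 L U z κ‖ ≤ x₀) (hx₀ : x₀ ≤ 1 / 32) {κ ν : Fin d} (hκν : κ < ν)
    (z : B7Prop1Explicit.Site d) :
    ‖flux (precomp L U) (z, ⟨(κ, ν), hκν⟩) - flux U (z, ⟨(κ, ν), hκν⟩) - fluxShift L U z κ ν‖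
      ≤ 156 * x₀ ^ 2 + 24 * x₀ * a := by
  rcases isEmpty_or_nonempty n with hn | hn
  · rw [show flux (precomp L U) (z, ⟨(κ, ν), hκν⟩) - flux U (z, ⟨(κ, ν), hκν⟩) - fluxShift L U z κ ν = 0 from
      Subsingleton.elim _ _, norm_zero]
    have h0 : 0 ≤ x₀ := (norm_nonneg _).trans (hX z κ)
    have ha0 : 0 ≤ a := (norm_nonneg _).trans (hs z κ ν (ne_of_lt hκν))
    positivity
  have hx0 : 0 ≤ x₀ := (norm_nonneg _).trans (hX z κ)
  have ha0 : 0 ≤ a := (norm_nonneg _).trans (hs z κ ν (ne_of_lt hκν))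
  -- the four insertions as matrices, their unitarity and sizes
  have hQ : threeSides U z κ ν ∈ unitaryUnits (Matrix n n ℂ) :=
    (unitaryUnits _).mul_mem ((unitaryUnits _).mul_mem (hU _ _) (hU _ _)) ((unitaryUnits _).inv_mem (hU _ _))
  have hP : hol U z (plaqWord κ ν) ∈ unitaryUnits (Matrix n n ℂ) := hol_mem_of hU _ _
  have u1 : ins1 L U z κ ∈ unitaryUnits (Matrix n n ℂ) := expUnit_neg_X0_mem_unitary L hU hs ha z κ
  have u2 : ins2 L U z κ ν ∈ unitaryUnits (Matrix n n ℂ) :=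
    (unitaryUnits _).mul_mem ((unitaryUnits _).mul_mem (hU _ _) (expUnit_neg_X0_mem_unitary L hU hs ha _ _))
      ((unitaryUnits _).inv_mem (hU _ _))
  have u3 : ins3 L U z κ ν ∈ unitaryUnits (Matrix n n ℂ) :=
    (unitaryUnits _).mul_mem ((unitaryUnits _).mul_mem hQ (expUnit_X0_mem_unitary L hU hs ha _ _))
      ((unitaryUnits _).inv_mem hQ)
  have u4 : ins4 L U z κ ν ∈ unitaryUnits (Matrix n n ℂ) :=
    (unitaryUnits _).mul_mem ((unitaryUnits _).mul_mem hP (expUnit_X0_mem_unitary L hU hs ha _ _))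
      ((unitaryUnits _).inv_mem hP)
  have v1 : ((ins1 L U z κ : (Matrix n n ℂ)ˣ) : Matrix n n ℂ) = exp (-X0 L U z κ) := rfl
  have v2 : ((ins2 L U z κ ν : (Matrix n n ℂ)ˣ) : Matrix n n ℂ) = Ad (U z κ) (exp (-X0 L U (z + e κ) ν)) := by
    simp only [ins2, Units.val_mul, val_expUnit, Ad]
  have v3 : ((ins3 L U z κ ν : (Matrix n n ℂ)ˣ) : Matrix n n ℂ) = Ad (threeSides U z κ ν) (exp (X0 L U (z + e ν) κ)) := by
    simp only [ins3, Units.val_mul, val_expUnit, Ad]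
  have v4 : ((ins4 L U z κ ν : (Matrix n n ℂ)ˣ) : Matrix n n ℂ) = Ad (hol U z (plaqWord κ ν)) (exp (X0 L U z ν)) := by
    simp only [ins4, Units.val_mul, val_expUnit, Ad]
  set ε : ℝ := Real.exp x₀ - 1 with hεdef
  have hε2 : ε ≤ 2 * x₀ := by
    have h := Real.abs_exp_sub_one_le (x := x₀) (by rw [abs_of_nonneg hx0]; linarith)
    rw [abs_of_nonneg hx0] at h
    exact (le_abs_self _).trans h
  have hεnn : 0 ≤ ε := by have := Real.add_one_le_exp x₀; rw [hεdef]; linarith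
  set f₁ : Matrix n n ℂ := ((ins1 L U z κ : (Matrix n n ℂ)ˣ) : Matrix n n ℂ)
  set f₂ : Matrix n n ℂ := ((ins2 L U z κ ν : (Matrix n n ℂ)ˣ) : Matrix n n ℂ)
  set f₃ : Matrix n n ℂ := ((ins3 L U z κ ν : (Matrix n n ℂ)ˣ) : Matrix n n ℂ)
  set f₄ : Matrix n n ℂ := ((ins4 L U z κ ν : (Matrix n n ℂ)ˣ) : Matrix n n ℂ)
  have d1 : ‖f₁ - 1‖ ≤ ε := by
    rw [v1]; refine (norm_exp_sub_one_le_of_norm_le ?_).1; rw [norm_neg]; exact hX _ _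
  have d2 : ‖f₂ - 1‖ ≤ ε := by rw [v2]; exact norm_Ad_exp_sub_one_le (hU z κ) _ (by rw [norm_neg]; exact hX _ _)
  have d3 : ‖f₃ - 1‖ ≤ ε := by rw [v3]; exact norm_Ad_exp_sub_one_le hQ _ (hX _ _)
  have d4 : ‖f₄ - 1‖ ≤ ε := by rw [v4]; exact norm_Ad_exp_sub_one_le hP _ (hX _ _)
  have l1 : ‖f₁ - 1 - (-X0 L U z κ)‖ ≤ expRem x₀ := by
    rw [v1]; refine (norm_exp_sub_one_le_of_norm_le ?_).2; rw [norm_neg]; exact hX _ _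
  have l2 : ‖f₂ - 1 - Ad (U z κ) (-X0 L U (z + e κ) ν)‖ ≤ expRem x₀ := by
    rw [v2]; exact norm_Ad_exp_sub_one_sub_le (hU z κ) _ (by rw [norm_neg]; exact hX _ _)
  have l3 : ‖f₃ - 1 - Ad (threeSides U z κ ν) (X0 L U (z + e ν) κ)‖ ≤ expRem x₀ := by
    rw [v3]; exact norm_Ad_exp_sub_one_sub_le hQ _ (hX _ _)
  have l4 : ‖f₄ - 1 - Ad (hol U z (plaqWord κ ν)) (X0 L U z ν)‖ ≤ expRem x₀ := by
    rw [v4]; exact norm_Ad_exp_sub_one_sub_le hP _ (hX _ _)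
  have n2 : ‖f₂‖ ≤ 1 := (mem_U1_of_unitary u2).1
  have n3 : ‖f₃‖ ≤ 1 := (mem_U1_of_unitary u3).1
  have n4 : ‖f₄‖ ≤ 1 := (mem_U1_of_unitary u4).1
  have hrem : expRem x₀ ≤ x₀ ^ 2 := expRem_le_sq hx0 (by linarith)
  -- E = f₁f₂f₃f₄, E − 1 − D
  set E : Matrix n n ℂ := f₁ * f₂ * f₃ * f₄ with hEdef
  have hED : ‖E - 1 - fluxShift L U z κ ν‖ ≤ 28 * x₀ ^ 2 := by
    have hsplit : E - 1 - fluxShift L U z κ ν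
        = (E - 1 - ((f₁ - 1) + (f₂ - 1) + (f₃ - 1) + (f₄ - 1)))
          + ((f₁ - 1 - (-X0 L U z κ)) + (f₂ - 1 - Ad (U z κ) (-X0 L U (z + e κ) ν))
            + (f₃ - 1 - Ad (threeSides U z κ ν) (X0 L U (z + e ν) κ))
            + (f₄ - 1 - Ad (hol U z (plaqWord κ ν)) (X0 L U z ν))) := by
      rw [fluxShift, Ad_neg]; abel
    rw [hsplit]
    refine (norm_add_le _ _).trans ?_
    have hA := norm_prod4_sub_one_sub_sum_le d1 d2 d3 d4 n2 n3
    have hB : ‖(f₁ - 1 - (-X0 L U z κ)) + (f₂ - 1 - Ad (U z κ) (-X0 L U (z + e κ) ν))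
            + (f₃ - 1 - Ad (threeSides U z κ ν) (X0 L U (z + e ν) κ))
            + (f₄ - 1 - Ad (hol U z (plaqWord κ ν)) (X0 L U z ν))‖ ≤ 4 * expRem x₀ := by
      refine (norm_add_le _ _).trans ?_
      refine (add_le_add ((norm_add_le _ _).trans (add_le_add ((norm_add_le _ _).trans (add_le_add l1 l2)) l3)) l4).trans ?_
      linarith
    nlinarith
  have hE1 : ‖E - 1‖ ≤ 4 * ε := norm_prod4_sub_one_le d1 d2 d3 d4 n2 n3 n4
  -- the two plaquette holonomies
  set P : Matrix n n ℂ := ((hol U z (plaqWord κ ν) : (Matrix n n ℂ)ˣ) : Matrix n n ℂ) with hPdef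
  have hTP : ((hol (precomp L U) z (plaqWord κ ν) : (Matrix n n ℂ)ˣ) : Matrix n n ℂ) = E * P := by
    rw [hol_precomp_plaqWord_eq]; simp only [Units.val_mul, hEdef, hPdef, f₁, f₂, f₃, f₄]
  have nP : ‖P‖ ≤ 1 := (mem_U1_of_unitary hP).1
  have hPa : ‖P - 1‖ ≤ a := hs z κ ν (ne_of_lt hκν)
  set ρ : ℝ := 8 * x₀ + a with hρdef
  have hρ1 : ρ < 1 := by rw [hρdef]; linarith
  have hρhalf : ρ ≤ 1 / 2 := by rw [hρdef]; linarith
  have hEP1 : ‖E * P - 1‖ ≤ ρ := by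
    have : E * P - 1 = (E - 1) * P + (P - 1) := by noncomm_ring
    rw [this]
    refine (norm_add_le _ _).trans ?_
    have := norm_mul_le (E - 1) P
    rw [hρdef]; nlinarith [norm_nonneg (E - 1)]
  have hP1 : ‖P - 1‖ ≤ ρ := by rw [hρdef]; linarith
  have hlog := FederbushMean.norm_mlog_sub_mlog_sub_le hρ1 hEP1 hP1
  have hfrac : ρ / (1 - ρ) ≤ 2 * ρ := by
    rw [div_le_iff₀ (by linarith)]; nlinarith
  have hEPP : E * P - P = (E - 1) + (E - 1) * (P - 1) := by noncomm_ring
  have hEPPn : ‖E * P - P‖ ≤ 4 * ε := by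
    rw [show E * P - P = (E - 1) * P by noncomm_ring]
    exact (norm_mul_le _ _).trans (by nlinarith [norm_nonneg (E - 1)])
  -- assemble
  have hsplit : flux (precomp L U) (z, ⟨(κ, ν), hκν⟩) - flux U (z, ⟨(κ, ν), hκν⟩) - fluxShift L U z κ ν
      = (mlog (E * P) - mlog P - (E * P - P)) + (E - 1 - fluxShift L U z κ ν) + (E - 1) * (P - 1) := by
    rw [show flux (precomp L U) (z, ⟨(κ, ν), hκν⟩) = mlog (E * P) by rw [flux, fhol, hTP],
      show flux U (z, ⟨(κ, ν), hκν⟩) = mlog P from rfl, hEPP]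
    abel
  have hρ0 : 0 ≤ ρ := by rw [hρdef]; positivity
  have t1 : ρ / (1 - ρ) * ‖E * P - P‖ ≤ 16 * ρ * x₀ :=
    calc ρ / (1 - ρ) * ‖E * P - P‖ ≤ 2 * ρ * ‖E * P - P‖ := mul_le_mul_of_nonneg_right hfrac (norm_nonneg _)
      _ ≤ 2 * ρ * (4 * ε) := by gcongr
      _ ≤ 2 * ρ * (4 * (2 * x₀)) := by gcongr
      _ = 16 * ρ * x₀ := by ring
  have t3 : ‖(E - 1) * (P - 1)‖ ≤ 8 * x₀ * a :=
    calc ‖(E - 1) * (P - 1)‖ ≤ ‖E - 1‖ * ‖P - 1‖ := norm_mul_le _ _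
      _ ≤ (4 * ε) * a := mul_le_mul hE1 hPa (norm_nonneg _) (by positivity)
      _ ≤ (4 * (2 * x₀)) * a := by gcongr
      _ = 8 * x₀ * a := by ring
  rw [hsplit]
  calc _ ≤ ‖mlog (E * P) - mlog P - (E * P - P)‖ + ‖E - 1 - fluxShift L U z κ ν‖ + ‖(E - 1) * (P - 1)‖ :=
        (norm_add_le _ _).trans (add_le_add (norm_add_le _ _) le_rfl)
    _ ≤ 16 * ρ * x₀ + 28 * x₀ ^ 2 + 8 * x₀ * a := add_le_add (add_le_add (hlog.trans t1) hED) t3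
    _ = 156 * x₀ ^ 2 + 24 * x₀ * a := by rw [hρdef]; ring

end Flux

end

end Summit.QuantumFields.BalabanUV.T4Continuum.SkeletonPrecompFlux
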